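import Mathlib
import HarnessLib.Audit
import Summits.PneNP.PneNP.Theorems.PstarFreshGateTools
import Summits.PneNP.PneNP.Theorems.PstarChordBridgeKill
import Summits.PneNP.PneNP.Theorems.PstarGSystemFreeVar

/-!
# A fresh gate forces a single-chord core (ROUND-24, memo §10.1 / §13.2, O2; targets `TerminalFiveMaxSharing` / `TerminalFiveA`)

FRONTIER range-avoidance ladder, rung F-N3, ROUND 24 (cell `pnp-ideate`, planner memo `r24/CORE-BOUND-NOTES.md` §10 (R6), §10.1 (gate-read
family), §13.2 (maximal-sharing regime: every private-touching reader is a gate `(p_e, z)` with `z` OUTSIDE the core); typed targets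
`PstarCoreBoundTargets.TerminalFiveA` / `TerminalFiveMaxSharing` (p646951); restricted-model proof complexity — nothing here bears on `P` versus `NP`).

A fresh gate (`PstarFreshGateTools.FreshGate`: reader `g₀ = (p, z)` on a private `p` of the chord `e₀`, `z` isolated, every other reader off the
privates) makes `flip z` a gate symmetry (`PstarChordSystemGate.Gate`) of the model `sys I (trim B)`: products, state-free parts and all other
reads invariant, the read vector of `p` shifted by `d = dir B g₀ ≠ 0`.

* `eq_singleton_of_gate` — the model-level dichotomy: reads of `e₀` PARALLEL to `d` ⇒ gated free lunch (`free_lunch_of_gate`: infeasible modulo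
  `d`), which the caller refutes; TRANSVERSAL ⇒ `eq_of_transversal` (pairwise killability + M-read + constant reads elsewhere) ⇒ `E = {e₀}`;
* `false_of_modShift` — the model of a terminal core is never infeasible modulo a gate direction: the transverse G-constraint (`w₂`, `w₁` or
  `w₁ ⊕ w₂`, `PstarGSystemFreeVar.gval_symmDiff`) would be violated by every solution of `J₀` yet satisfied by the (M0) witness of `e₀`
  (`false_of_violated`, i.e. `PstarGSat.gSat`);
* `N_eq_singleton_of_freshGate` — **a fresh gate forces `N = {e₀}`**: pure typed instance with simple overlaps, `(r,3/2)`-expanding; WF bridge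
  data with `#J₀ ≤ r`, monomials off the core, Lift, (T3) unsolvable, (M0) solvable after deleting any chord (`PstarChordBridgeKill.killable_pair`
  supplies pairwise killability); a fresh gate on `e₀` ⇒ `e₀` is the only chord.

With `PstarNorUnitRegime.J₀_eq_of_single` such a core is one XOR cycle `D e₀ + e₀`.  Not treated here: the single-chord endgame with a gate (CONS-T
with an idle gate `(p, z)` in `w₂` realises the transversal case at `#J₀ = 3`) and NON-isolated gate variables (`z ∈ Cᵢ`, `(σ, z)` readers:
`δ ≠ 0` in `PstarChordSystemGate`).
-/

set_option linter.dupNamespace false -- `Summit.PneNP.PneNP.…`: summit = sub-problem name (D-0017 single-conjunct layout)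

open Finset Literature.Computability.Complexity
open scoped symmDiff
open Summit.PneNP.PneNP.Theorems.PstarFibrePolys (bit bit_xor bit_injective)
open Summit.PneNP.PneNP.Theorems.PstarPDT (parity)
open Summit.PneNP.PneNP.Theorems.PstarTyped (Typed)
open Summit.PneNP.PneNP.Theorems.PstarSALevel (varSet bdry BoundaryExpanding SimpleOverlap)
open Summit.PneNP.PneNP.Theorems.PstarCentreFree (vars_mem_varSet)
open Summit.PneNP.PneNP.Theorems.PstarGapOneAll (gval)
open Summit.PneNP.PneNP.Theorems.PstarGSat (gSat)
open Summit.PneNP.PneNP.Theorems.PstarGSystemFreeVar (gval_symmDiff)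
open Summit.PneNP.PneNP.Theorems.PstarReadSumset (V2)
open Summit.PneNP.PneNP.Theorems.PstarChordSystem (ChordSystem)
open Summit.PneNP.PneNP.Theorems.PstarChordSystemGate
open Summit.PneNP.PneNP.Theorems.PstarChordBridgeTools
open Summit.PneNP.PneNP.Theorems.PstarChordBridge
open Summit.PneNP.PneNP.Theorems.PstarChordBridgeKill (killable_pair)

open Summit.PneNP.PneNP.Theorems.PstarFreshGateTools

namespace Summit.PneNP.PneNP.Theorems.PstarFreshGate

variable {n m : ℕ}

/-- Every element of `𝔽₂` is `0` or `1`. -/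
private theorem zmod2_cases (t : ZMod 2) : t = 0 ∨ t = 1 := by
  revert t; decide

/-! ## The model-level core of the argument -/

/-- In `𝔽₂²`: `c + a • d ∈ {0, d}` iff `c ∈ {0, d}` (`a ∈ 𝔽₂`). -/
private theorem mem_pair_iff (c d : V2) (a : ZMod 2) : (c + a • d = 0 ∨ c + a • d = d) ↔ (c = 0 ∨ c = d) := by
  rcases zmod2_cases a with rfl | rfl
  · rw [zero_smul, add_zero]
  · rw [one_smul]
    have : ∀ c d : V2, (c + d = 0 ∨ c + d = d) ↔ (c = 0 ∨ c = d) := by decide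
    exact this c d

/-- **The dichotomy, model level.**  A gate (`δ = 0`, `d ≠ 0`) on `e₀ ∈ E` whose first read is `c + x_z • d` and whose second read is the
constant `r'`, in an infeasible system with constant reads elsewhere, pairwise killability and chord-minimality: if infeasibility modulo `d` is
contradictory (`hlunch`), then `E = {e₀}`. -/
theorem eq_singleton_of_gate {A : Type*} {S : ChordSystem (Fin m) A} {φ : A → A} {e₀ : Fin m} {d : V2} (G : Gate S φ e₀ d fun _ => 0)
    (hd : d ≠ 0) {E : Finset (Fin m)} (hI : S.Infeasible E) (he₀ : e₀ ∈ E) {c r' : V2} {ζ : A → ZMod 2}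
    (hρ₀ : ∀ a, S.ρ e₀ a = c + ζ a • d) (hρ₀' : ∀ a, S.ρ' e₀ a = r')
    (hconst : ∀ e ∈ E, e ≠ e₀ → ∀ a a', S.ρ e a = S.ρ e a' ∧ S.ρ' e a = S.ρ' e a')
    (hK : ∀ e ∈ E, ∀ e' ∈ E, e ≠ e' → ∃ a, S.u e a = 0 ∧ S.u e' a = 0) (hM : ∀ e ∈ E, S.ChordMinimal E e)
    (hlunch : (∀ a s, S.Adm E a s → S.val E a s ≠ S.t + d) → False) : E = {e₀} := by
  by_cases hpar : (c = 0 ∨ c = d) ∧ (r' = 0 ∨ r' = d)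
  · exact (hlunch (free_lunch_of_gate G (fun _ => rfl)
      (fun a => ⟨by rw [hρ₀ a, mem_pair_iff]; exact hpar.1, by rw [hρ₀' a]; exact hpar.2⟩) hI he₀)).elim
  · have htr : ∀ a, S.u e₀ a = 0 → ¬ (S.ρ e₀ a = 0 ∨ S.ρ e₀ a = d) ∨ ¬ (S.ρ' e₀ a = 0 ∨ S.ρ' e₀ a = d) := by
      intro a _
      rw [hρ₀ a, hρ₀' a, mem_pair_iff]
      exact not_and_or.1 hpar
    exact eq_singleton_iff_unique_mem.2 ⟨he₀, eq_of_transversal G hd (fun _ => rfl) hI he₀ htr hconst hK hM⟩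

/-! ## The instance-level conclusion -/

/-- Missing `t` and `t + (1,0)` in `𝔽₂²` means missing the second coordinate of `t`. -/
private theorem snd_ne_of (v t : V2) (h₁ : v ≠ t) (h₂ : v ≠ t + (1, 0)) : v.2 ≠ t.2 := by
  revert v t; decide

/-- Missing `t` and `t + (0,1)` in `𝔽₂²` means missing the first coordinate of `t`. -/
private theorem fst_ne_of (v t : V2) (h₁ : v ≠ t) (h₂ : v ≠ t + (0, 1)) : v.1 ≠ t.1 := by
  revert v t; decide

/-- Missing `t` and `t + (1,1)` in `𝔽₂²` means missing the coordinate sum of `t`. -/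
private theorem sum_ne_of (v t : V2) (h₁ : v ≠ t) (h₂ : v ≠ t + (1, 1)) : v.1 + v.2 ≠ t.1 + t.2 := by
  revert v t; decide

/-- **The model of a terminal core is never infeasible modulo a gate direction.**  If no admissible state of `sys I (trim B)` hits `t` nor
`t + dir B g₀` (`g₀ ∈ G₁ ∪ G₂`), then every solution of `J₀` violates the transverse G-constraint, while the (M0) witness of a chord satisfies it:
`false_of_violated`. -/
theorem false_of_modShift (I : LocalMap 4 n m) (hI : I.IsPure xorAndPred) (hT : Typed I) (hS : SimpleOverlap I) {r : ℕ}
    (hB : BoundaryExpanding r I) {B : BridgeData n m} (hW : B.WF I) (hJr : B.J₀.card ≤ r) (hG₁ : Disjoint B.G₁ B.J₀)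
    (hG₂ : Disjoint B.G₂ B.J₀) {g₀ : Fin m} (hg₀ : g₀ ∈ B.G₁ ∪ B.G₂) {e₀ : Fin m} (he₀ : e₀ ∈ B.N)
    (hM0 : ∃ z, Solution I B (B.J₀.erase e₀) z) (hinf : (sys I (trim B)).Infeasible B.N)
    (hmod : ∀ a s, (sys I (trim B)).Adm B.N a s → (sys I (trim B)).val B.N a s ≠ (sys I (trim B)).t + dir B g₀) : False := by
  classical
  have hW' := wf_trim I hW
  -- every solution of `J₀` misses `t` and `t + d` in the model
  have key : ∀ z : Fin n → Bool, (∀ j ∈ B.J₀, I.eval z j = B.y j) →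
      ((bit (gval I B.C₁ B.G₁ z), bit (gval I B.C₂ B.G₂ z)) : V2) ≠ (bit B.b₁, bit B.b₂) ∧
      ((bit (gval I B.C₁ B.G₁ z), bit (gval I B.C₂ B.G₂ z)) : V2) ≠ (bit B.b₁, bit B.b₂) + dir B g₀ := by
    intro z hz
    have hz' : ∀ j ∈ (trim B).J₀ \ (trim B).N, I.eval z j = (trim B).y j := fun j hj => hz j (mem_sdiff.1 hj).1
    have hadm : (sys I (trim B)).Adm B.N (fun v => bit (z v)) (fun e => (bit (z (I.vars e 2)), bit (z (I.vars e 3)))) :=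
      fun e he => (eval_iff_adm I hI hW' hz' he).1 (hz e (hW.hN he))
    have hval := val_of_solution I hI hT hW' hz'
    exact ⟨fun h => hinf _ _ hadm (hval.trans h), fun h => hmod _ _ hadm (hval.trans h)⟩
  have hne : B.J₀.Nonempty := ⟨e₀, hW.hN he₀⟩
  obtain ⟨z₁, -, hz₁, hz₂⟩ := hM0
  by_cases h1 : g₀ ∈ B.G₁ <;> by_cases h2 : g₀ ∈ B.G₂
  · -- `d = (1,1)`: the sum constraint
    have hd : dir B g₀ = (1, 1) := by unfold dir; rw [if_pos h1, if_pos h2]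
    refine false_of_violated I hI hT hS hB B.y hne hJr (C := B.C₁ ∆ B.C₂) (G := B.G₁ ∆ B.G₂) (b := xor B.b₁ B.b₂)
      (disjoint_of_subset_right (symmDiff_subset_union (s := B.G₁) (t := B.G₂)) (disjoint_union_right.2 ⟨hG₁.symm, hG₂.symm⟩))
      (fun z hz h => ?_) ⟨z₁, by rw [gval_symmDiff, hz₁, hz₂]⟩
    obtain ⟨k₁, k₂⟩ := key z hz
    rw [hd] at k₂
    have := sum_ne_of _ _ k₁ k₂
    rw [gval_symmDiff] at h
    exact this (by simp only; rw [← bit_xor, ← bit_xor, h])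
  · -- `d = (1,0)`: the second constraint
    have hd : dir B g₀ = (1, 0) := by unfold dir; rw [if_pos h1, if_neg h2]
    refine false_of_violated I hI hT hS hB B.y hne hJr hG₂.symm (fun z hz h => ?_) ⟨z₁, hz₂⟩
    obtain ⟨k₁, k₂⟩ := key z hz
    rw [hd] at k₂
    exact snd_ne_of _ _ k₁ k₂ (by simp only; rw [h])
  · -- `d = (0,1)`: the first constraint
    have hd : dir B g₀ = (0, 1) := by unfold dir; rw [if_neg h1, if_pos h2]
    refine false_of_violated I hI hT hS hB B.y hne hJr hG₁.symm (fun z hz h => ?_) ⟨z₁, hz₁⟩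
    obtain ⟨k₁, k₂⟩ := key z hz
    rw [hd] at k₂
    exact fst_ne_of _ _ k₁ k₂ (by simp only; rw [h])
  · exact absurd hg₀ (by rw [mem_union, not_or]; exact ⟨h1, h2⟩)

/-- **A fresh gate forces a single-chord core: `N = {e₀}`.**  Pure typed instance with simple overlaps, `(r,3/2)`-expanding; well-formed bridge
data with `#J₀ ≤ r`, monomial outputs off the core, Lift, (T3) unsolvable and (M0) solvable after deleting any chord; a fresh gate on the chord
`e₀` (`FreshGate`).  Then `e₀` is the only chord. -/
theorem N_eq_singleton_of_freshGate (I : LocalMap 4 n m) (hI : I.IsPure xorAndPred) (hT : Typed I) (hS : SimpleOverlap I) {r : ℕ}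
    (hB : BoundaryExpanding r I) {B : BridgeData n m} (hW : B.WF I) (hJr : B.J₀.card ≤ r) (hG₁ : Disjoint B.G₁ B.J₀)
    (hG₂ : Disjoint B.G₂ B.J₀) (hL : Lift I B) (hT3 : ¬ ∃ z, Solution I B B.J₀ z) (hM0 : ∀ e ∈ B.N, ∃ z, Solution I B (B.J₀.erase e) z)
    {e₀ g₀ : Fin m} {s₀ : Fin 4} {z : Fin n} (h : FreshGate I B e₀ g₀ s₀ z) : B.N = {e₀} := by
  classical
  have hW' := wf_trim I hW
  set S := sys I (trim B) with hSdef
  have hinf : S.Infeasible B.N := infeasible_of_not_solution I hI hT hW' hL hT3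
  have hM : ∀ e ∈ B.N, S.ChordMinimal B.N e := fun e he => by
    obtain ⟨zz, hz⟩ := hM0 e he
    exact chordMinimal_of_solution_erase I hI hT hW' he hz
  have hK : ∀ e ∈ B.N, ∀ e' ∈ B.N, e ≠ e' → ∃ a, S.u e a = 0 ∧ S.u e' a = 0 := killable_pair I hI hS hB hW' hJr
  have hd := h.dir_ne_zero
  -- the privates of the other chords, and the other private of `e₀`, differ from `p`
  have hne2 : ∀ e ∈ B.N, e ≠ e₀ → I.vars e 2 ≠ I.vars e₀ s₀ := fun e he hne hv =>
    hne (chord_eq_of_vars_eq I hW.hN hW.hchord he (hW.hN h.he₀) (s := 2) (by decide) hv).symm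
  have hne3 : ∀ e ∈ B.N, e ≠ e₀ → I.vars e 3 ≠ I.vars e₀ s₀ := fun e he hne hv =>
    hne (chord_eq_of_vars_eq I hW.hN hW.hchord he (hW.hN h.he₀) (s := 3) (by decide) hv).symm
  have hconst : ∀ e ∈ B.N, e ≠ e₀ → ∀ a a', S.ρ e a = S.ρ e a' ∧ S.ρ' e a = S.ρ' e a' := by
    intro e he hne a a'
    have h2 := h.unread_of_ne hW (vars_mem_privs I he (s := 2) (by decide)) (hne2 e he hne)
    have h3 := h.unread_of_ne hW (vars_mem_privs I he (s := 3) (by decide)) (hne3 e he hne)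
    rw [hSdef, sys_trim_ρ I B he, sys_trim_ρ I B he, sys_trim_ρ' I B he, sys_trim_ρ' I B he,
      PstarChordBridgeForcing.coef_of_unread I h2.1, PstarChordBridgeForcing.coef_of_unread I h2.2,
      PstarChordBridgeForcing.coef_of_unread I h3.1, PstarChordBridgeForcing.coef_of_unread I h3.2,
      PstarChordBridgeForcing.coef_of_unread I h2.1, PstarChordBridgeForcing.coef_of_unread I h2.2,
      PstarChordBridgeForcing.coef_of_unread I h3.1, PstarChordBridgeForcing.coef_of_unread I h3.2]
    exact ⟨rfl, rfl⟩
  have hlunch : (∀ a s, S.Adm B.N a s → S.val B.N a s ≠ S.t + dir B g₀) → False :=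
    false_of_modShift I hI hT hS hB hW hJr hG₁ hG₂ h.hg₀ h.he₀ (hM0 e₀ h.he₀) hinf
  -- invariants of the flip
  have hinv := h.invariants hW
  have hρ_of : ∀ e, e ≠ e₀ → ∀ x, S.ρ e (PstarFreshGateTools.flip z x) = S.ρ e x := by
    intro e hne x
    by_cases he : e ∈ B.N
    · rw [hSdef, sys_trim_ρ I B he, sys_trim_ρ I B he]
      obtain ⟨h₁, h₂⟩ := (hinv x).2.2 _ (vars_mem_privs I he (s := 2) (by decide)) (hne2 e he hne)
      rw [h₁, h₂]
    · rw [hSdef, (sys_trim_ρ_of_not_mem I B he _).1, (sys_trim_ρ_of_not_mem I B he _).1]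
  have hρ'_of : ∀ e, (e ∈ B.N → I.vars e 3 ≠ I.vars e₀ s₀) → ∀ x, S.ρ' e (PstarFreshGateTools.flip z x) = S.ρ' e x := by
    intro e hne x
    by_cases he : e ∈ B.N
    · rw [hSdef, sys_trim_ρ' I B he, sys_trim_ρ' I B he]
      obtain ⟨h₁, h₂⟩ := (hinv x).2.2 _ (vars_mem_privs I he (s := 3) (by decide)) (hne he)
      rw [h₁, h₂]
    · rw [hSdef, (sys_trim_ρ_of_not_mem I B he _).2, (sys_trim_ρ_of_not_mem I B he _).2]
  have hρ2_of : ∀ e, (e ∈ B.N → I.vars e 2 ≠ I.vars e₀ s₀) → ∀ x, S.ρ e (PstarFreshGateTools.flip z x) = S.ρ e x := by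
    intro e hne x
    by_cases he : e ∈ B.N
    · rw [hSdef, sys_trim_ρ I B he, sys_trim_ρ I B he]
      obtain ⟨h₁, h₂⟩ := (hinv x).2.2 _ (vars_mem_privs I he (s := 2) (by decide)) (hne he)
      rw [h₁, h₂]
    · rw [hSdef, (sys_trim_ρ_of_not_mem I B he _).1, (sys_trim_ρ_of_not_mem I B he _).1]
  -- the gated slot: `2` or `3`
  have hs23 : s₀ = 2 ∨ s₀ = 3 := by
    have := h.hs₀; rcases s₀ with ⟨s, hs4⟩; simp only [Fin.ext_iff] at *; omega
  set c : V2 := (if I.vars e₀ s₀ ∈ B.C₁ then 1 else 0, if I.vars e₀ s₀ ∈ B.C₂ then 1 else 0) with hc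
  rcases hs23 with rfl | rfl
  · -- gate on the first private
    have G : Gate S (PstarFreshGateTools.flip z) e₀ (dir B g₀) fun _ => 0 :=
      { hu := fun e x => (hinv x).2.1 e
        hF := fun x => ((hinv x).1).trans (add_zero _).symm
        hρ := fun e x hne => hρ_of e hne x
        hρ' := fun e x => hρ'_of e (fun heN => by
          by_cases he : e = e₀
          · rw [he]; exact fun h' => absurd (hI.2 e₀ h') (by decide)
          · exact hne3 e heN he) x
        hρ₀ := fun x => by
          rw [hSdef, sys_trim_ρ I B h.he₀, sys_trim_ρ I B h.he₀]
          exact h.readVec_p_flip hW x }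
    refine eq_singleton_of_gate G hd hinf h.he₀ (c := c) (ζ := fun x => x z)
      (r' := (coef I B.C₁ B.G₁ (I.vars e₀ 3) 0, coef I B.C₂ B.G₂ (I.vars e₀ 3) 0)) (fun x => ?_) (fun x => ?_) hconst hK hM hlunch
    · rw [hSdef, sys_trim_ρ I B h.he₀]; exact h.readVec_p hW x
    · have h3 := h.unread_of_ne hW (vars_mem_privs I h.he₀ (s := 3) (by decide)) (fun h' => absurd (hI.2 e₀ h') (by decide))
      rw [hSdef, sys_trim_ρ' I B h.he₀, PstarChordBridgeForcing.coef_of_unread I h3.1, PstarChordBridgeForcing.coef_of_unread I h3.2,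
        PstarChordBridgeForcing.coef_of_unread I h3.1, PstarChordBridgeForcing.coef_of_unread I h3.2]
  · -- gate on the second private: exchange the privates of `e₀`
    have G : Gate (swap S e₀) (PstarFreshGateTools.flip z) e₀ (dir B g₀) fun _ => 0 :=
      gate_swap (fun e x => (hinv x).2.1 e) (fun x => ((hinv x).1).trans (add_zero _).symm)
        (fun e x => hρ2_of e (fun heN => by
          by_cases he : e = e₀
          · rw [he]; exact fun h' => absurd (hI.2 e₀ h') (by decide)
          · exact hne2 e heN he) x)
        (fun e x hne => hρ'_of e (fun heN => hne3 e heN hne) x)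
        (fun x => by
          rw [hSdef, sys_trim_ρ' I B h.he₀, sys_trim_ρ' I B h.he₀]
          exact h.readVec_p_flip hW x)
    have hinf' : (swap S e₀).Infeasible B.N := (infeasible_swap S e₀ B.N).2 hinf
    have hM' : ∀ e ∈ B.N, (swap S e₀).ChordMinimal B.N e := fun e he => (chordMinimal_swap S e₀ B.N e).2 (hM e he)
    have hconst' : ∀ e ∈ B.N, e ≠ e₀ → ∀ a a', (swap S e₀).ρ e a = (swap S e₀).ρ e a' ∧ (swap S e₀).ρ' e a = (swap S e₀).ρ' e a' := by
      intro e he hne a a'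
      rw [swap_ρ_of_ne S hne, swap_ρ_of_ne S hne, swap_ρ'_of_ne S hne, swap_ρ'_of_ne S hne]
      exact hconst e he hne a a'
    have hlunch' : (∀ a s, (swap S e₀).Adm B.N a s → (swap S e₀).val B.N a s ≠ (swap S e₀).t + dir B g₀) → False := by
      intro hmod
      refine hlunch fun a s hadm => ?_
      have := hmod a (swapState e₀ s) ((adm_swap S e₀ B.N a s).2 hadm)
      rw [val_swap] at this
      exact this
    refine eq_singleton_of_gate G hd hinf' h.he₀ (c := c) (ζ := fun x => x z)
      (r' := (coef I B.C₁ B.G₁ (I.vars e₀ 2) 0, coef I B.C₂ B.G₂ (I.vars e₀ 2) 0)) (fun x => ?_) (fun x => ?_) hconst' hK hM' hlunch'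
    · rw [swap_ρ_self, hSdef, sys_trim_ρ' I B h.he₀]; exact h.readVec_p hW x
    · have h2 := h.unread_of_ne hW (vars_mem_privs I h.he₀ (s := 2) (by decide)) (fun h' => absurd (hI.2 e₀ h') (by decide))
      rw [swap_ρ'_self, hSdef, sys_trim_ρ I B h.he₀, PstarChordBridgeForcing.coef_of_unread I h2.1,
        PstarChordBridgeForcing.coef_of_unread I h2.2, PstarChordBridgeForcing.coef_of_unread I h2.1,
        PstarChordBridgeForcing.coef_of_unread I h2.2]

end Summit.PneNP.PneNP.Theorems.PstarFreshGate
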